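import Mathlib
import HarnessLib
import Literature.Probability.MarkovChains.PeskunOrdering

/-!
# Skew detailed balance: `(μ,Q)`-reversibility for an involution `Q`, its `μ`-invariance and `Q`-symmetrisations, and the lifted Metropolis–Hastings kernel of Turitsyn–Chertkov–Vucelja (Andrieu–Livingstone 2021, §2.1 and §3.3)

HONEST FRAMING: exact (Metropolis-corrected) sampling algorithms for lattice gauge theory; figures
of merit are autocorrelation/cost numbers at stated couplings and volumes; no continuum-physics claim.

Conventions of `MetropolisHastings.lean` / `TotalVariation.lean` / `PeskunOrdering.lean` (finite
state spaces, ROW kernels `P : X → X → ℝ`, `IsRowStochastic`, `IsStationary π P` = "`πP = π`",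
`DetailedBalance π P`, `piInner π g h = ⟨g,h⟩_π`).  Source: C. Andrieu, S. Livingstone,
*Peskun–Tierney ordering for Markovian Monte Carlo: beyond the reversible scenario*, Ann. Statist.
49 (2021) 1958–1981 [AndrieuLivingstone2021] (held: `paper:doi-10-1214-20-aos2008`, §2.1 pp. 4–5
and §3.3 p. 14), with the constructions it attributes to [TuritsynChertkovVucelja2011],
[Vucelja2016] and [HukushimaSakai2013].  Everything below is PROVED (finite sums; 0 named facts).
THE THEOREMS OF [AndrieuLivingstone2021] ON THE ORDERING OF ASYMPTOTIC VARIANCES (Theorems 2–7)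
ARE NOT FORMALISED HERE (their proofs are in the paper's supplement, not held) — this file types
the NOTION and the exactness statements only.

THE NOTION (finite form).  An ISOMETRIC INVOLUTION [cite: AndrieuLivingstone2021, §2.1 Def. 1 and
Lemma 1] is `Qf = f ∘ ξ` for an involution `ξ : X → X` preserving `μ` (`μ ∘ ξ = μ`); a Markov
kernel `P` is `(μ,Q)`-SELF-ADJOINT / `(μ,Q)`-REVERSIBLE when `⟨Pf, g⟩_μ = ⟨f, QPQg⟩_μ` for all
`f, g` [cite: AndrieuLivingstone2021, §2.1 Def. 2]; on indicator functions `f = 1_{y}`, `g = 1_{x}`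
this reads **`μ(x)P(x,y) = μ(y)P(ξy, ξx)`** for all `x, y` — `SkewDetailedBalance μ ξ P` — the
"skew detailed balance condition" of [cite: HukushimaSakai2013, skew detailed balance (as attributed in AndrieuLivingstone2021 §3.3 / Vucelja2016 §5)] /
[cite: TuritsynChertkovVucelja2011, skew detailed balance (as restated in Vucelja2016 §5)].  `Q = Id` (`ξ = id`) is ordinary detailed balance
(`skewDetailedBalance_id_iff`).

* `SkewDetailedBalance.piInner_mulVec` — the operator form `⟨Pf, g⟩_μ = ⟨f, QPQg⟩_μ` FOLLOWS from
  the kernel form (and `skewDetailedBalance_of_piInner`: conversely, testing on indicators), for an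
  involution `ξ` preserving `μ` [cite: AndrieuLivingstone2021, §2.1 Def. 2];
* **`SkewDetailedBalance.isStationary` — a `(μ,Q)`-reversible kernel leaves `μ` invariant**
  (`Σ_x μ(x)P(x,y) = μ(y)Σ_x P(ξy,ξx) = μ(y)`) [cite: AndrieuLivingstone2021, §2.2 ("Markov chain
  … of transition kernel `P` leaving `μ` invariant")] [cite: HukushimaSakai2013, skew detailed balance (as attributed in AndrieuLivingstone2021 §3.3 / Vucelja2016 §5)];
* **PROPOSITION 1** [cite: AndrieuLivingstone2021, §2.1 Prop. 1 and Def. 3]: the left and right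
  `Q`-symmetrisations `QP` (`(QP)(x,y) = P(ξx,y)`) and `PQ` (`(PQ)(x,y) = P(x,ξy)`) of a
  `(μ,Q)`-reversible `P` are `μ`-REVERSIBLE (`SkewDetailedBalance.detailedBalance_flipComp`,
  `SkewDetailedBalance.detailedBalance_compFlip`); conversely the `Q`-symmetrisations of a
  `μ`-reversible kernel are `(μ,Q)`-reversible (`DetailedBalance.skewDetailedBalance_flipComp`,
  `…_compFlip`), so "a `(μ,Q)`-self-adjoint Markov operator is always the composition of two
  `μ`-self-adjoint Markov operators" (`P = Q(QP)`).
* **THE LIFTED METROPOLIS–HASTINGS KERNEL** [cite: AndrieuLivingstone2021, §3.3 eqs. (5)–(7)]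
  (after [cite: TuritsynChertkovVucelja2011, lifted two-replica construction (as restated in Vucelja2016 §5 and AndrieuLivingstone2021 §3.3)] and [cite: Vucelja2016, §5 (Lifting: skew detailed balance, stationarity of `π̃ = ½(π,π)`, minimal switching rates)]): sub-kernels
  `T_v` (`v ∈ {+1,−1}`, here `Bool`) on `X` with `T_v ≥ 0`, `T_v(x,X) ≤ 1` and the skew pair
  condition **(5) `π(x)T_v(x,y) = π(y)T_{−v}(y,x)`**, switching rates `ρ_{v,−v}(x)` with
  `0 ≤ ρ_{v,−v}(x) ≤ 1 − T_v(x,X)` and **(7) `ρ_{v,−v}(x) − ρ_{−v,v}(x) = T_{−v}(x,X) − T_v(x,X)`**;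
  the lifted kernel on `E = X × {±1}`,
  `P^lifted((x,v); (y,w)) = 1{w = −v}δ_x(y)ρ_{v,−v}(x) + 1{w = v}[T_v(x,y) + δ_x(y)(1 − T_v(x,X) −
  ρ_{v,−v}(x))]` (`liftedMH T ρ`), is a transition matrix (`liftedMH_rowSum`, `liftedMH_nonneg`) and
  **is `(μ,Q)`-reversible for `μ(x,v) = ½π(x)` and the velocity flip `Q f(x,v) = f(x,−v)`**
  (`liftedMH_skewDetailedBalance` — "It is not difficult to check that under (5) and (7) `P^lifted`
  is `(μ,Q)`-self-adjoint"), hence **leaves `π ⊗ ½` invariant** (`liftedMH_isStationary`) and its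
  flip-symmetrisation is `μ`-reversible (`liftedMH_flipComp_detailedBalance`); the canonical
  switching rate `ρ̃_{v,−v}(x) = max{0, T_{−v}(x,X) − T_v(x,X)}` satisfies the constraints
  (`canonicalRate_bounds`, `canonicalRate_eq7`) [cite: AndrieuLivingstone2021, §3.3 (the display
  after (7))] [cite: HukushimaSakai2013, switching-rate solutions (as attributed in AndrieuLivingstone2021 §3.3)]; and the un-lifted mixture (6)
  `P = ½T₊ + ½T₋ + δ_x(1 − ½T₊(x,X) − ½T₋(x,X))` is `π`-reversible (`mixtureMH_detailedBalance`)
  [cite: AndrieuLivingstone2021, §3.3 eq. (6)].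

Context (cell pub-lqcd, venture LatticeQCDFlow): skew detailed balance with the momentum /
direction flip is the exactness certificate of every lifted sampler (guided walk, event-chain,
generalised HMC with partial refreshment, the venture's PTBC translation lifts); with
`LiftingMixingTimeBounds.lean` (what lifting can gain) and `VorticityAsymptoticVariance.lean`
(vorticity never loses) it completes the tree's vocabulary for non-reversible exact samplers.
-/

namespace Literature.Probability.MarkovChains

open Finset Matrix

variable {X : Type*} [Fintype X] [DecidableEq X]

/-! ## Skew detailed balance -/

omit [Fintype X] [DecidableEq X] in
/-- **`(μ,Q)`-reversibility in kernel form / skew detailed balance**: `μ(x)P(x,y) = μ(y)P(ξy,ξx)` for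
all `x, y`, for an involution `ξ` of the state space (`Qf = f ∘ ξ`). [cite: AndrieuLivingstone2021,
§2.1 Def. 2 (read on indicator functions)] [cite: HukushimaSakai2013, title notion (skew detailed balance), as attributed in AndrieuLivingstone2021 §3.3] [cite: TuritsynChertkovVucelja2011, skew detailed balance (as restated in Vucelja2016 §5)] -/
def SkewDetailedBalance (μ : X → ℝ) (ξ : X → X) (P : X → X → ℝ) : Prop :=
  ∀ x y, μ x * P x y = μ y * P (ξ y) (ξ x)

omit [Fintype X] [DecidableEq X] in
/-- With the identity involution, skew detailed balance is detailed balance.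
[cite: AndrieuLivingstone2021, §2.1 Def. 2 ("When `Q = Id` we will simply say that `P` is
`μ`-self adjoint or `μ`-reversible")] -/
theorem skewDetailedBalance_id_iff (μ : X → ℝ) (P : X → X → ℝ) :
    SkewDetailedBalance μ id P ↔ DetailedBalance μ P :=
  ⟨fun h x y => h x y, fun h x y => h x y⟩

namespace SkewDetailedBalance

variable {μ : X → ℝ} {ξ : X → X} {P : X → X → ℝ}

omit [DecidableEq X] in
/-- **A `(μ,Q)`-reversible kernel leaves `μ` invariant**: `Σ_x μ(x)P(x,y) = μ(y)Σ_x P(ξy,ξx) = μ(y)`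
(rows of `P` sum to `1`; `ξ` a bijection). [cite: AndrieuLivingstone2021, §2.2 (the chain "of
transition kernel `P` leaving `μ` invariant")] [cite: HukushimaSakai2013, skew detailed balance (as attributed in AndrieuLivingstone2021 §3.3 / Vucelja2016 §5)] -/
theorem isStationary (h : SkewDetailedBalance μ ξ P) (hξ : Function.Involutive ξ)
    (hrow : ∀ x, ∑ y, P x y = 1) : IsStationary μ P := by
  intro y
  simp_rw [h _ y]
  rw [← mul_sum]
  have hs : ∑ x, P (ξ y) (ξ x) = ∑ x, P (ξ y) x :=
    Equiv.sum_comp (hξ.toPerm ξ) (fun x => P (ξ y) x)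
  rw [hs, hrow, mul_one]

omit [Fintype X] [DecidableEq X] in
/-- **Proposition 1, left symmetrisation**: for a `(μ,Q)`-reversible `P` with `μ ∘ ξ = μ`, the kernel
`QP`, `(QP)(x,y) = P(ξx,y)`, is `μ`-reversible. [cite: AndrieuLivingstone2021, §2.1 Prop. 1 and
Def. 3] -/
theorem detailedBalance_flipComp (h : SkewDetailedBalance μ ξ P) (hξ : Function.Involutive ξ)
    (hμ : ∀ x, μ (ξ x) = μ x) : DetailedBalance μ (fun x y => P (ξ x) y) := by
  intro x y
  have := h (ξ x) y
  rw [hξ x, hμ x] at this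
  exact this

omit [Fintype X] [DecidableEq X] in
/-- **Proposition 1, right symmetrisation**: for a `(μ,Q)`-reversible `P` with `μ ∘ ξ = μ`, the
kernel `PQ`, `(PQ)(x,y) = P(x,ξy)`, is `μ`-reversible. [cite: AndrieuLivingstone2021, §2.1 Prop. 1
and Def. 3] -/
theorem detailedBalance_compFlip (h : SkewDetailedBalance μ ξ P) (hξ : Function.Involutive ξ)
    (hμ : ∀ x, μ (ξ x) = μ x) : DetailedBalance μ (fun x y => P x (ξ y)) := by
  intro x y
  have := h x (ξ y)
  rw [hξ y, hμ y] at this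
  exact this

omit [DecidableEq X] in
/-- The operator form of Definition 2 follows from the kernel form: `⟨Pf, g⟩_μ = ⟨f, QPQg⟩_μ`, where
`(QPQg)(x) = Σ_y P(ξx, y) g(ξy)` (for an involution `ξ` preserving `μ`).
[cite: AndrieuLivingstone2021, §2.1 Def. 2] -/
theorem piInner_mulVec (h : SkewDetailedBalance μ ξ P) (hξ : Function.Involutive ξ)
    (f g : X → ℝ) :
    piInner μ (fun x => ∑ y, P x y * f y) g = piInner μ f (fun x => ∑ y, P (ξ x) y * g (ξ y)) := by
  unfold piInner
  -- left: Σ_x Σ_y μ x P x y f y g x ; right: Σ_x Σ_y μ x f x P(ξx,y) g(ξy)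
  calc ∑ x, μ x * ((∑ y, P x y * f y) * g x)
      = ∑ x, ∑ y, μ x * P x y * f y * g x := by
        refine sum_congr rfl fun x _ => ?_
        rw [sum_mul, mul_sum]
        exact sum_congr rfl fun y _ => by ring
    _ = ∑ x, ∑ y, μ y * P (ξ y) (ξ x) * f y * g x := by
        refine sum_congr rfl fun x _ => sum_congr rfl fun y _ => ?_
        rw [h x y]
    _ = ∑ y, ∑ x, μ y * P (ξ y) (ξ x) * f y * g x := sum_comm
    _ = ∑ y, ∑ x, μ y * P (ξ y) x * f y * g (ξ x) := by
        refine sum_congr rfl fun y _ => ?_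
        have := Equiv.sum_comp (hξ.toPerm ξ) (fun x => μ y * P (ξ y) x * f y * g (ξ x))
        simp only [Function.Involutive.coe_toPerm, hξ _] at this
        rw [← this]
    _ = ∑ y, μ y * (f y * ∑ x, P (ξ y) x * g (ξ x)) := by
        refine sum_congr rfl fun y _ => ?_
        rw [mul_sum, mul_sum]
        exact sum_congr rfl fun x _ => by ring

/-- Conversely, the operator form on indicator functions gives the kernel form.
[cite: AndrieuLivingstone2021, §2.1 Def. 2] -/
theorem _root_.Literature.Probability.MarkovChains.skewDetailedBalance_of_piInner
    (hξ : Function.Involutive ξ)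
    (hop : ∀ f g : X → ℝ, piInner μ (fun x => ∑ y, P x y * f y) g
      = piInner μ f (fun x => ∑ y, P (ξ x) y * g (ξ y))) :
    SkewDetailedBalance μ ξ P := by
  intro a b
  -- test on the indicators `f = 1_{b}`, `g = 1_{a}`
  have hL : piInner μ (fun x => ∑ y, P x y * (if y = b then (1 : ℝ) else 0))
      (fun x => if x = a then (1 : ℝ) else 0) = μ a * P a b := by
    unfold piInner
    have h1 : ∀ x, μ x * ((∑ y, P x y * (if y = b then (1 : ℝ) else 0)) * (if x = a then (1 : ℝ) else 0))
        = if x = a then μ a * P a b else 0 := by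
      intro x
      have hy : ∑ y, P x y * (if y = b then (1 : ℝ) else 0) = P x b := by
        simp only [mul_ite, mul_one, mul_zero, Finset.sum_ite_eq', Finset.mem_univ, if_true]
      rw [hy]
      by_cases hx : x = a
      · rw [if_pos hx, if_pos hx, hx, mul_one]
      · rw [if_neg hx, if_neg hx, mul_zero, mul_zero]
    simp_rw [h1, Finset.sum_ite_eq', Finset.mem_univ, if_true]
  have hR : piInner μ (fun y => if y = b then (1 : ℝ) else 0)
      (fun x => ∑ y, P (ξ x) y * (if ξ y = a then (1 : ℝ) else 0)) = μ b * P (ξ b) (ξ a) := by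
    unfold piInner
    have inner : ∀ x, ∑ y, P (ξ x) y * (if ξ y = a then (1 : ℝ) else 0) = P (ξ x) (ξ a) := by
      intro x
      have h2 : ∀ y, P (ξ x) y * (if ξ y = a then (1 : ℝ) else 0)
          = if y = ξ a then P (ξ x) y else 0 := by
        intro y
        by_cases hy : y = ξ a
        · rw [if_pos hy, if_pos (by rw [hy, hξ a]), mul_one]
        · rw [if_neg hy, if_neg (fun h' => hy (by rw [← h', hξ y])), mul_zero]
      simp_rw [h2, Finset.sum_ite_eq', Finset.mem_univ, if_true]
    simp_rw [inner]
    have h3 : ∀ x, μ x * ((if x = b then (1 : ℝ) else 0) * P (ξ x) (ξ a))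
        = if x = b then μ b * P (ξ b) (ξ a) else 0 := by
      intro x
      by_cases hx : x = b
      · rw [if_pos hx, if_pos hx, hx, one_mul]
      · rw [if_neg hx, if_neg hx, zero_mul, mul_zero]
    simp_rw [h3, Finset.sum_ite_eq', Finset.mem_univ, if_true]
  have h := hop (fun y => if y = b then (1 : ℝ) else 0) (fun x => if x = a then (1 : ℝ) else 0)
  rw [hL, hR] at h
  exact h

end SkewDetailedBalance

omit [Fintype X] [DecidableEq X] in
/-- The `Q`-symmetrisations of a `μ`-REVERSIBLE kernel are `(μ,Q)`-reversible (Proposition 1, the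
"resp." clause), left version `(QP)(x,y) = P(ξx,y)`. [cite: AndrieuLivingstone2021, §2.1 Prop. 1] -/
theorem DetailedBalance.skewDetailedBalance_flipComp {μ : X → ℝ} {P : X → X → ℝ}
    (h : DetailedBalance μ P) {ξ : X → X} (hξ : Function.Involutive ξ) (hμ : ∀ x, μ (ξ x) = μ x) :
    SkewDetailedBalance μ ξ (fun x y => P (ξ x) y) := by
  intro x y
  show μ x * P (ξ x) y = μ y * P (ξ (ξ y)) (ξ x)
  rw [hξ y, ← hμ x]
  exact h (ξ x) y

omit [Fintype X] [DecidableEq X] in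
/-- The `Q`-symmetrisations of a `μ`-REVERSIBLE kernel are `(μ,Q)`-reversible, right version
`(PQ)(x,y) = P(x,ξy)`. [cite: AndrieuLivingstone2021, §2.1 Prop. 1] -/
theorem DetailedBalance.skewDetailedBalance_compFlip {μ : X → ℝ} {P : X → X → ℝ}
    (h : DetailedBalance μ P) {ξ : X → X} (hξ : Function.Involutive ξ) (hμ : ∀ x, μ (ξ x) = μ x) :
    SkewDetailedBalance μ ξ (fun x y => P x (ξ y)) := by
  intro x y
  show μ x * P x (ξ y) = μ y * P (ξ y) (ξ (ξ x))
  rw [hξ x, h x (ξ y), hμ y]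

/-! ## The lifted Metropolis–Hastings kernel (Turitsyn–Chertkov–Vucelja) -/

section Lifted

variable (π : X → ℝ) (T : Bool → X → X → ℝ) (ρ : Bool → X → ℝ)

/-- The lifted state space is `E = X × {±1}` (velocities as `Bool`), the lifted target
`μ(x,v) = ½π(x)` ("`μ(d(x,v)) = π(dx)ϖ(v) = ½π(dx)1{v ∈ {−1,1}}`").
[cite: AndrieuLivingstone2021, §3.3 (the display before (7))] -/
noncomputable def liftLaw : X × Bool → ℝ := fun a => π a.1 / 2

omit [Fintype X] [DecidableEq X] in
/-- The velocity flip `(x,v) ↦ (x,−v)`, the involution behind `Qf(x,v) = f(x,−v)`.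
[cite: AndrieuLivingstone2021, §3.3 ("for `Q` such that `Qf(x,v) = f(x,−v)`")] -/
def flipV : X × Bool → X × Bool := fun a => (a.1, !a.2)

omit [Fintype X] [DecidableEq X] in
/-- The velocity flip is an involution. [cite: AndrieuLivingstone2021, §3.3] -/
theorem flipV_involutive : Function.Involutive (flipV (X := X)) := by
  intro a
  simp [flipV]

omit [Fintype X] [DecidableEq X] in
/-- `μ` is flip-invariant. [cite: AndrieuLivingstone2021, §3.3] -/
theorem liftLaw_flipV (a : X × Bool) : liftLaw π (flipV a) = liftLaw π a := rfl

/-- **The lifted kernel** `P^lifted((x,v); (y,w)) = 1{w = −v}δ_x(y)ρ_{v,−v}(x) +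
1{w = v}[T_v(x,y) + δ_x(y)(1 − T_v(x,X) − ρ_{v,−v}(x))]` — move with the sub-kernel of the
current velocity, stay put with the leftover mass, or flip the velocity at rate `ρ_{v,−v}`
("imposing `P^lifted((x,v); (A∖{x}) × {−v}) = 0`"). [cite: AndrieuLivingstone2021, §3.3 (the
display defining `P^lifted`)] [cite: TuritsynChertkovVucelja2011, lifted two-replica construction (as restated in Vucelja2016 §5 and AndrieuLivingstone2021 §3.3)] [cite: Vucelja2016, §5 (Lifting: skew detailed balance, stationarity of `π̃ = ½(π,π)`, minimal switching rates)] -/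
noncomputable def liftedMH : X × Bool → X × Bool → ℝ := fun a b =>
  if b.2 = a.2 then T a.2 a.1 b.1 + (if b.1 = a.1 then 1 - ∑ z, T a.2 a.1 z - ρ a.2 a.1 else 0)
  else (if b.1 = a.1 then ρ a.2 a.1 else 0)

/-- Rows of `P^lifted` sum to `1`. [cite: AndrieuLivingstone2021, §3.3 (definition of `P^lifted`)] -/
theorem liftedMH_rowSum (a : X × Bool) : ∑ b, liftedMH T ρ a b = 1 := by
  obtain ⟨x, v⟩ := a
  rw [Fintype.sum_prod_type]
  simp only [Fintype.sum_bool]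
  have hsplit : ∀ y : X, liftedMH T ρ (x, v) (y, true) + liftedMH T ρ (x, v) (y, false)
      = (T v x y + (if y = x then 1 - ∑ z, T v x z - ρ v x else 0))
        + (if y = x then ρ v x else 0) := by
    intro y
    cases v
    · have e1 : liftedMH T ρ (x, false) (y, true) = if y = x then ρ false x else 0 := by
        simp [liftedMH]
      have e2 : liftedMH T ρ (x, false) (y, false)
          = T false x y + (if y = x then 1 - ∑ z, T false x z - ρ false x else 0) := by
        simp [liftedMH]
      rw [e1, e2]
      ring
    · have e1 : liftedMH T ρ (x, true) (y, true)
          = T true x y + (if y = x then 1 - ∑ z, T true x z - ρ true x else 0) := by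
        simp [liftedMH]
      have e2 : liftedMH T ρ (x, true) (y, false) = if y = x then ρ true x else 0 := by
        simp [liftedMH]
      rw [e1, e2]
  simp_rw [hsplit, sum_add_distrib, Finset.sum_ite_eq', Finset.mem_univ, if_true]
  ring

/-- `P^lifted ≥ 0` under the printed constraints `T_v ≥ 0`, `0 ≤ ρ_{v,−v}(x) ≤ 1 − T_v(x,X)`.
[cite: AndrieuLivingstone2021, §3.3 ("required to satisfy … `0 ≤ ρ_{v,−v}(x) ≤ 1 − T_v(x,X)`")] -/
theorem liftedMH_nonneg (hT : ∀ v x y, 0 ≤ T v x y) (hρ0 : ∀ v x, 0 ≤ ρ v x)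
    (hρ1 : ∀ v x, ρ v x ≤ 1 - ∑ z, T v x z) (a b : X × Bool) : 0 ≤ liftedMH T ρ a b := by
  unfold liftedMH
  split_ifs with h1 h2 h3
  · have := hρ1 a.2 a.1; have := hT a.2 a.1 b.1; linarith
  · rw [add_zero]; exact hT a.2 a.1 b.1
  · exact hρ0 a.2 a.1
  · exact le_rfl

/-- `P^lifted` is a transition matrix under the printed constraints.
[cite: AndrieuLivingstone2021, §3.3] -/
theorem liftedMH_isRowStochastic (hT : ∀ v x y, 0 ≤ T v x y) (hρ0 : ∀ v x, 0 ≤ ρ v x)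
    (hρ1 : ∀ v x, ρ v x ≤ 1 - ∑ z, T v x z) : IsRowStochastic (liftedMH T ρ) :=
  ⟨liftedMH_nonneg T ρ hT hρ0 hρ1, liftedMH_rowSum T ρ⟩

/-- **`P^lifted` is `(μ,Q)`-reversible** for `μ = π ⊗ ½` and the velocity flip, under the skew pair
condition (5) `π(x)T_v(x,y) = π(y)T_{−v}(y,x)` and the switching-rate identity (7)
`ρ_{v,−v}(x) − ρ_{−v,v}(x) = T_{−v}(x,X) − T_v(x,X)` ("It is not difficult to check that under (5)
and (7) `P^lifted` is `(μ,Q)`-self-adjoint, for `Q` such that `Qf(x,v) = f(x,−v)`").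
[cite: AndrieuLivingstone2021, §3.3 eqs. (5), (7)] [cite: TuritsynChertkovVucelja2011, lifted two-replica construction (as restated in Vucelja2016 §5 and AndrieuLivingstone2021 §3.3)]
[cite: HukushimaSakai2013, skew detailed balance (as attributed in AndrieuLivingstone2021 §3.3 / Vucelja2016 §5)] -/
theorem liftedMH_skewDetailedBalance (h5 : ∀ v x y, π x * T v x y = π y * T (!v) y x)
    (h7 : ∀ v x, ρ v x - ρ (!v) x = ∑ z, T (!v) x z - ∑ z, T v x z) :
    SkewDetailedBalance (liftLaw π) flipV (liftedMH T ρ) := by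
  rintro ⟨x, v⟩ ⟨y, w⟩
  simp only [liftLaw, flipV, liftedMH]
  by_cases hw : w = v
  · subst hw
    rw [if_pos rfl, if_pos rfl]
    by_cases hy : y = x
    · subst hy
      rw [if_pos rfl, if_pos rfl]
      -- diagonal entry: (5) at `y = x`, and (7)
      have h5' := h5 w y y
      have h7' := h7 w y
      have e : (1 - ∑ z, T w y z - ρ w y) = (1 - ∑ z, T (!w) y z - ρ (!w) y) := by linarith
      have key : π y * (T w y y + (1 - ∑ z, T w y z - ρ w y))
          = π y * (T (!w) y y + (1 - ∑ z, T (!w) y z - ρ (!w) y)) := by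
        rw [mul_add, mul_add, h5', e]
      linear_combination (1 / 2 : ℝ) * key
    · rw [if_neg hy, if_neg (Ne.symm hy), add_zero, add_zero]
      linear_combination (1 / 2 : ℝ) * h5 w x y
  · have hw' : w = !v := by
      cases v <;> cases w <;> simp_all
    subst hw'
    rw [if_neg hw]
    have hne : ¬ ((!v) = !!v) := by cases v <;> decide
    rw [if_neg hne]
    simp only [Bool.not_not]
    by_cases hy : y = x
    · subst hy
      rw [if_pos rfl]
    · rw [if_neg hy, if_neg (Ne.symm hy), mul_zero, mul_zero]

/-- **`P^lifted` leaves `π ⊗ ½` invariant** (skew detailed balance with the velocity flip, whose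
rows sum to one). [cite: AndrieuLivingstone2021, §3.3 with §2.2] [cite: TuritsynChertkovVucelja2011, as
restated in Vucelja2016 §5] [cite: Vucelja2016, §5 (Lifting: skew detailed balance, stationarity of `π̃ = ½(π,π)`, minimal switching rates)] -/
theorem liftedMH_isStationary (h5 : ∀ v x y, π x * T v x y = π y * T (!v) y x)
    (h7 : ∀ v x, ρ v x - ρ (!v) x = ∑ z, T (!v) x z - ∑ z, T v x z) :
    IsStationary (liftLaw π) (liftedMH T ρ) :=
  (liftedMH_skewDetailedBalance π T ρ h5 h7).isStationary flipV_involutive (liftedMH_rowSum T ρ)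

/-- The flip-symmetrisation `QP^lifted`, `((y,w) ↦ P^lifted((x,−v);(y,w)))`, is `μ`-reversible
(Proposition 1 for the lifted kernel). [cite: AndrieuLivingstone2021, §2.1 Prop. 1 with §3.3] -/
theorem liftedMH_flipComp_detailedBalance (h5 : ∀ v x y, π x * T v x y = π y * T (!v) y x)
    (h7 : ∀ v x, ρ v x - ρ (!v) x = ∑ z, T (!v) x z - ∑ z, T v x z) :
    DetailedBalance (liftLaw π) (fun a b => liftedMH T ρ (flipV a) b) :=
  (liftedMH_skewDetailedBalance π T ρ h5 h7).detailedBalance_flipComp flipV_involutive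
    (liftLaw_flipV π)

/-- The CANONICAL switching rate `ρ̃_{v,−v}(x) = max{0, T_{−v}(x,X) − T_v(x,X)}`.
[cite: AndrieuLivingstone2021, §3.3 ("There are numerous known solutions … including
`ρ̃_{v,−v}(x) := max{0, T_{−v}(x,X) − T_v(x,X)}`")] [cite: HukushimaSakai2013, switching-rate solutions (as attributed in AndrieuLivingstone2021 §3.3)] -/
noncomputable def canonicalRate : Bool → X → ℝ := fun v x => max 0 (∑ z, T (!v) x z - ∑ z, T v x z)

omit [DecidableEq X] in
/-- The canonical rate satisfies (7). [cite: AndrieuLivingstone2021, §3.3 eq. (7)] -/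
theorem canonicalRate_eq7 (v : Bool) (x : X) :
    canonicalRate T v x - canonicalRate T (!v) x = ∑ z, T (!v) x z - ∑ z, T v x z := by
  simp only [canonicalRate, Bool.not_not]
  rcases le_total (∑ z, T (!v) x z) (∑ z, T v x z) with h | h
  · rw [max_eq_left (by linarith), max_eq_right (by linarith)]; ring
  · rw [max_eq_right (by linarith), max_eq_left (by linarith)]; ring

omit [DecidableEq X] in
/-- The canonical rate satisfies the bounds `0 ≤ ρ̃_{v,−v}(x) ≤ 1 − T_v(x,X)` as soon as the
sub-kernels have mass at most one (`T_{−v}(x,X) ≤ 1`). [cite: AndrieuLivingstone2021, §3.3] -/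
theorem canonicalRate_bounds (hT1 : ∀ v x, ∑ z, T v x z ≤ 1) (v : Bool) (x : X) :
    0 ≤ canonicalRate T v x ∧ canonicalRate T v x ≤ 1 - ∑ z, T v x z := by
  refine ⟨le_max_left _ _, max_le (by linarith [hT1 v x]) (by linarith [hT1 (!v) x])⟩

/-- The un-lifted mixture (6), `P = ½T₊ + ½T₋ + δ_x(1 − ½T₊(x,X) − ½T₋(x,X))`, is `π`-REVERSIBLE
under (5) ("A standard way of constructing a `π`-reversible Markov transition based on the above
sub-kernels"). [cite: AndrieuLivingstone2021, §3.3 eq. (6)] -/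
theorem mixtureMH_detailedBalance (h5 : ∀ v x y, π x * T v x y = π y * T (!v) y x) :
    DetailedBalance π (fun x y => (1 / 2) * T true x y + (1 / 2) * T false x y
      + (if y = x then 1 - (1 / 2) * ∑ z, T true x z - (1 / 2) * ∑ z, T false x z else 0)) := by
  intro x y
  by_cases hy : y = x
  · subst hy; rfl
  · simp only [if_neg hy, if_neg (Ne.symm hy), add_zero]
    have h1 := h5 true x y
    have h2 := h5 false x y
    simp only [Bool.not_true, Bool.not_false] at h1 h2
    linarith

end Lifted

end Literature.Probability.MarkovChains
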